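import Literature.Geometry.Kaehler.ComplexTorusIntegralHodgeClassesLefschetzDecompositionUniform
import Literature.Geometry.Kaehler.ComplexTorusRealHodgeLefschetzPieceLatticesDefinite
import HarnessLib

/-!
# The Lefschetz pieces `Lˢ Hdgⁱ(X, ℤ)_prim` of the integral Hodge lattice: pairwise `B`-orthogonal over `ℤ`, Hodge–Riemann sign `(−1)ⁱ`,
# INDEPENDENT, and of finite index in `Hdgᵖ(X, ℤ)` with a uniform exponent

Layer `Literature/Geometry/Kaehler`, namespace `Literature.Geometry.Kaehler.ComplexTorus`; lane `lit-hodgefound`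
(Track 2 foundations library), seat p09, generation 47, row g47-#3. THEOREMS ONLY (0 definitions); no named fact, net debt 0.
Assembles g47-#2 (`ComplexTorusIntegralHodgeClassesLefschetzDecompositionUniform`: `N·Hdgᵖ(X, ℤ) ⊆ Σ_{i ≤ p} L^{p−i} Hdgⁱ(X, ℤ)_prim`), the
form-level Lemma 6.31 of the tree (`lefschetzIntersectionForm_lefschetzPow_eq_zero_of_ne`: Lefschetz pieces of different levels are
`Q_k`-orthogonal) and Hodge–Riemann over `ℤ` on the real Hodge–Lefschetz pieces (g46-#3 / g46-#8:
`IsPolarizationType.mul_apply_self_pos_of_mem_posPart`, `map_lefschetzPow_primitiveForms_inf_typeSubmodule_sup_le_posPart`) into the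
STRUCTURE THEOREM of the integral Lefschetz decomposition of the Hodge lattice of a polarised abelian variety (`g = j + 2`, type `(d₁, …, d_g)`,
even degree `k = p + p` with `k + q = g`, `B = B_k = ⟨·, γ_q ∧ ·⟩_e` on `Hᵏ(X, ℤ)`, `s' = sign·(−1)^q`, `L = lefschetzPow η`):

* §0 A lattice generality: a family of submodules which are pairwise `B`-orthogonal and on each of which `B` is anisotropic is INDEPENDENT
  (`iSupIndep_of_forall_apply_eq_zero_of_anisotropic`).
* §1 Elements `u = Lˢ y ∈ Hᵏ(X, ℤ)` with `y ∈ Hdgⁱ(X, ℤ)` primitive (`i + i = m`, `2s + m = k`): `Lˢ` preserves integrality and integral Hodge classes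
  (`lefschetzPow_mem_integralForms`, `lefschetzPow_mem_integralHodgeClassesIn`); **`B(Lˢ y, Lᵗ y') = 0` for `s ≠ t`** (Voisin's Lemma 6.31 on the
  lattice — the cross-piece orthogonality of the integral Lefschetz decomposition: `IsPolarizationType.apply_eq_zero_of_eq_lefschetzPow_of_ne`);
  **`(−1)ⁱ·s'·B(u, u) > 0` for `u ≠ 0`** (Hodge–Riemann over `ℤ` on the piece `Lˢ Hdgⁱ(X, ℤ)_prim`:
  `IsPolarizationType.neg_one_pow_mul_apply_self_pos_of_eq_lefschetzPow`).
* §2 The pieces as sublattices `N_s ⊆ Hᵏ(X, ℤ)` (`u ∈ N_s ⟺ u = Lˢ y`, `y ∈ Hdgⁱ(X, ℤ) ∩ P^m`, `2s + m = k`, `i + i = m`; they exist,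
  `exists_family_mem_iff_exists_eq_lefschetzPow`): **pairwise `B`-orthogonal, `B` anisotropic on each, hence `iSupIndep N`**
  (`IsPolarizationType.iSupIndep_lefschetzPieces`); each `N_s ⊆ Hdgᵖ(X, ℤ)`; and **`N₀ · Hdgᵖ(X, ℤ) ⊆ ⨆_s N_s` for ONE `N₀ ≥ 1`**
  (`IsPolarizationType.exists_forall_nsmul_mem_iSup_lefschetzPieces`, from g47-#2): the integral Lefschetz decomposition
  `Hdgᵖ(X, ℤ) ⊇ ⊕_{s} Lˢ Hdg^{p−s}(X, ℤ)_prim` is an ORTHOGONAL DIRECT sum of FINITE INDEX whose quotient has exponent dividing `N₀`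
  (Lange (5.22)–(5.23) for the Hodge lattice; Voisin Rem. 6.27).

## References

* [cite: VoisinHodgeI2002, §6.2.3 Lemma 6.26, Rem. 6.27 (PDF p. 126); §6.3.2 Lemma 6.31, Thm. 6.32 and (6.12) (PDF pp. 128–129); §7.1.2 (PDF p. 134)]
* [cite: Lange2023AbelianVarietiesComplex, §5.4.1 Thm. 5.4.2 and (5.22)–(5.23) (PDF p. 275); §7.3.2 (1), (3); §7.2.2]
* [cite: Huybrechts2016K3, Ch. 14 §0.2]
* [cite: Kitaoka1993, Ch. 5 Prop. 5.3.3 (proof)]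
-/

noncomputable section

-- `Module ℂ` / `SMulZeroClass ℂ` synthesis on `E [⋀^Fin k]→L[ℝ] ℂ` (as in `ComplexTorusLefschetzDecomposition`)
set_option maxSynthPendingDepth 3

open Module Function Complex
open LinearMap (BilinForm)
open Literature.LinearAlgebra.Alternating
open Literature.Analysis.Complex (IsOfTypeAt typeSubmodule)

namespace Literature.Geometry.Kaehler.ComplexTorus

/-! ## §0 Pairwise orthogonal + anisotropic ⟹ independent -/

section Generic

variable {R M : Type*} [CommRing R] [AddCommGroup M] [Module R M]

/-- **A family of submodules which are pairwise `B`-orthogonal and on each of which `B` is anisotropic is independent**: if `u ∈ N_s` also lies in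
`⨆_{t ≠ s} N_t` then `B(u, u) = 0` (`u` is `B`-orthogonal to every `N_t`, `t ≠ s`, hence to their span), so `u = 0`. The lattice version of
"an orthogonal decomposition is a direct sum decomposition" for definite pieces. [cite: Huybrechts2016K3, Ch. 14 §0.2] [cite: VoisinHodgeI2002, §6.3.2 Lemma 6.31, Thm. 6.32 (PDF p. 128)] -/
theorem iSupIndep_of_forall_apply_eq_zero_of_anisotropic (B : BilinForm R M) {σ : Type*} (N : σ → Submodule R M)
    (hO : ∀ s t, s ≠ t → ∀ u ∈ N s, ∀ v ∈ N t, B u v = 0) (hA : ∀ s, ∀ u ∈ N s, B u u = 0 → u = 0) : iSupIndep N := by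
  rw [iSupIndep_def]
  intro s
  rw [Submodule.disjoint_def]
  intro u hu hu'
  have key : ∀ v ∈ ⨆ (t) (_ : t ≠ s), N t, B u v = 0 := by
    intro v hv
    refine Submodule.iSup_induction (fun t ↦ ⨆ (_ : t ≠ s), N t) (motive := fun v ↦ B u v = 0) hv ?_ ?_ ?_
    · intro t x hx
      by_cases hts : t ≠ s
      · rw [iSup_pos hts] at hx
        exact hO s t (Ne.symm hts) u hu x hx
      · rw [iSup_neg hts, Submodule.mem_bot] at hx
        rw [hx, map_zero]
    · exact map_zero _
    · intro x y hx hy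
      rw [map_add, hx, hy, add_zero]
  exact hA s u hu (key u hu')

end Generic

/-! ## §1 Elements `Lˢ y` of the Lefschetz pieces: integrality, Hodge type, cross-piece orthogonality, Hodge–Riemann sign -/

section Elements

variable {ι : Type*} [Fintype ι] [DecidableEq ι] {E : Type*} [NormedAddCommGroup E] [NormedSpace ℂ E]
  {Φ : (ι → ℝ) ≃L[ℝ] E} {j n k q : ℕ} {η : E [⋀^Fin 2]→L[ℝ] ℝ} {d : Fin (j + 2) → ℕ}

omit [Fintype ι] [DecidableEq ι] in
/-- **`Lˢ Hᵐ(X, ℤ) ⊆ Hᵏ(X, ℤ)`** (`2s + m = k`): the bundled Lefschetz power of an integral class is integral (`θ ∈ H²(X, ℤ)`; `L` acts on integral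
cohomology). [cite: VoisinHodgeI2002, §7.1.2 (PDF p. 134)] [cite: Lange2023AbelianVarietiesComplex, §5.4.1 (5.22) (PDF p. 275)] -/
theorem lefschetzPow_mem_integralForms (hη : IsRiemannForm Φ η) {s m : ℕ} (h : 2 * s + m = k) {y : E [⋀^Fin m]→L[ℝ] ℂ}
    (hy : y ∈ integralForms Φ m) : lefschetzPow η s h y ∈ integralForms Φ k := by
  subst h
  rw [lefschetzPow_apply, domDomCongr_finCongr_self]
  exact wedgePow_wedge_mem_integralForms Φ hη.isNSForm s hy

omit [Fintype ι] [DecidableEq ι] in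
/-- **`Lˢ Hdgⁱ(X, ℤ) ⊆ Hdg^{s+i}(X, ℤ)`** (degrees `m ↦ 2s + m = k`): `θ^{∧s}` is an integral class of type `(s, s)` and the integral Hodge classes form a
ring. [cite: VoisinHodgeI2002, §6.2.3 Lemma 6.26; §7.1.2 (PDF p. 134)] [cite: Lange2023AbelianVarietiesComplex, §7.3.1; §7.3.2 (1)] -/
theorem lefschetzPow_mem_integralHodgeClassesIn (hη : IsRiemannForm Φ η) {s m i p : ℕ} (h : 2 * s + m = k) (hp : s + i = p)
    {y : E [⋀^Fin m]→L[ℝ] ℂ} (hy : y ∈ integralHodgeClassesIn Φ m i) : lefschetzPow η s h y ∈ integralHodgeClassesIn Φ k p := by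
  subst h hp
  rw [lefschetzPow_apply, domDomCongr_finCongr_self]
  exact wedgePow_wedge_mem_integralHodgeClassesIn Φ hη.isNSForm s hy

/-- **CROSS-PIECE ORTHOGONALITY OVER `ℤ` (Voisin's Lemma 6.31 on the lattice): `B_k(Lˢ y, Lᵗ y') = 0` for `s ≠ t`**, `y ∈ P^m`, `y' ∈ P^{m'}` primitive
(`2s + m = 2t + m' = k`), for the integral Lefschetz form `B_k = ⟨·, γ_q ∧ ·⟩_e` on `Hᵏ(X, ℤ)` (`k + q = g`): `q!·d₁⋯d_q·B_k(u, v) = ±Q_k(u, v)` and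
`Q_k(Lˢ y, Lᵗ y') = ∫ θ^{∧(q+s+t)} ∧ y ∧ y' = 0`, the primitive class of LARGER degree being killed by `θ^{∧(q+s+t)}` (`s + t > 2·min(s, t)`).
[cite: VoisinHodgeI2002, §6.3.2 Lemma 6.31 (PDF p. 128); §7.1.2 (PDF p. 134)] [cite: Lange2023AbelianVarietiesComplex, §5.4.1 Thm. 5.4.2 and (5.22) (PDF p. 275)] -/
theorem IsPolarizationType.apply_eq_zero_of_eq_lefschetzPow_of_ne (hd : IsPolarizationType Φ η d) (hη : IsRiemannForm Φ η)
    (hkq : k + q = j + 2) (hq : q ≤ j + 2) {γ : E [⋀^Fin (2 * q)]→L[ℝ] ℂ}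
    (hγ : wedgePow (ofRealForm η) q = ((q.factorial * ∏ i : Fin q, d (Fin.castLE hq i) : ℕ) : ℂ) • γ)
    (e : Fin n ≃ ι) (hn : k + (2 * q + k) = n) {B : BilinForm ℤ ↥(integralForms Φ k)}
    (hB : ∀ x y : ↥(integralForms Φ k),
      ((B x y : ℤ) : ℂ) = poincarePairing Φ e hn (x : E [⋀^Fin k]→L[ℝ] ℂ) (γ.wedge (y : E [⋀^Fin k]→L[ℝ] ℂ)))
    {s m t m' : ℕ} (h : 2 * s + m = k) (h' : 2 * t + m' = k) (hst : s ≠ t) {y : E [⋀^Fin m]→L[ℝ] ℂ} (hy : y ∈ primitiveForms η m)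
    {y' : E [⋀^Fin m']→L[ℝ] ℂ} (hy' : y' ∈ primitiveForms η m') {u v : ↥(integralForms Φ k)}
    (hu : (u : E [⋀^Fin k]→L[ℝ] ℂ) = lefschetzPow η s h y) (hv : (v : E [⋀^Fin k]→L[ℝ] ℂ) = lefschetzPow η t h' y') : B u v = 0 := by
  have h2 : 2 * (j + 2) = n := by omega
  have hc : ((q.factorial * ∏ i : Fin q, d (Fin.castLE hq i) : ℕ) : ℂ) ≠ 0 := by
    exact_mod_cast (Nat.mul_pos (Nat.factorial_pos q) (Finset.prod_pos fun i _ ↦ hd.pos hη _)).ne'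
  have hQ : lefschetzIntersectionForm Φ η ((finCongr h2).trans e) hkq (u : E [⋀^Fin k]→L[ℝ] ℂ) (v : E [⋀^Fin k]→L[ℝ] ℂ) = 0 := by
    rw [hu, hv]
    exact lefschetzIntersectionForm_lefschetzPow_eq_zero_of_ne (Φ := Φ) (η := η) ((finCongr h2).trans e) hkq h h' hst hy hy'
  have key := natCast_mul_poincarePairing_wedge_eq_of_wedgePow_eq_smul Φ hkq hq hγ e hn h2 (u : E [⋀^Fin k]→L[ℝ] ℂ) (v : E [⋀^Fin k]→L[ℝ] ℂ)
  rw [hQ, mul_zero] at key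
  apply Int.cast_injective (α := ℂ)
  rw [hB, Int.cast_zero]
  exact (mul_eq_zero.1 key).resolve_left hc

/-- **HODGE–RIEMANN OVER `ℤ` ON THE PIECE `Lˢ Hdgⁱ(X, ℤ)_prim`: `(−1)ⁱ · s' · B_k(u, u) > 0`** for `u = Lˢ y ≠ 0`, `y ∈ Hdgⁱ(X, ℤ)` primitive (`i + i = m`,
`2s + m = k`, `s' = sign·(−1)^q`): `Lˢ H^{i,i}_prim` lies in the positive part `V₊` of the real Hodge–Lefschetz parity decomposition for `i` even,
in `V₋` for `i` odd (g46-#8), where `s'·B_k` is positive, resp. negative, on non-zero integral classes (g46-#3).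
[cite: VoisinHodgeI2002, §6.3.2 Thm. 6.32 and (6.12) (PDF pp. 128–129); §6.2.3 Rem. 6.27; §7.1.2 (PDF p. 134)] -/
theorem IsPolarizationType.neg_one_pow_mul_apply_self_pos_of_eq_lefschetzPow (hd : IsPolarizationType Φ η d) (hη : IsRiemannForm Φ η)
    (hkq : k + q = j + 2) (hq : q ≤ j + 2) {γ : E [⋀^Fin (2 * q)]→L[ℝ] ℂ}
    (hγ : wedgePow (ofRealForm η) q = ((q.factorial * ∏ i : Fin q, d (Fin.castLE hq i) : ℕ) : ℂ) • γ)
    (e : Fin n ≃ ι) (hn : k + (2 * q + k) = n) {B : BilinForm ℤ ↥(integralForms Φ k)}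
    (hB : ∀ x y : ↥(integralForms Φ k),
      ((B x y : ℤ) : ℂ) = poincarePairing Φ e hn (x : E [⋀^Fin k]→L[ℝ] ℂ) (γ.wedge (y : E [⋀^Fin k]→L[ℝ] ℂ)))
    {s m i : ℕ} (hm : i + i = m) (h : 2 * s + m = k) {y : E [⋀^Fin m]→L[ℝ] ℂ} (hyH : y ∈ integralHodgeClassesIn Φ m i)
    (hyP : y ∈ primitiveForms η m) {u : ↥(integralForms Φ k)} (hu : (u : E [⋀^Fin k]→L[ℝ] ℂ) = lefschetzPow η s h y) (hu0 : u ≠ 0) :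
    0 < (-1) ^ i * (orientationSign Φ e * (-1) ^ q * B u u) := by
  have hk : Even k := ⟨s + i, by omega⟩
  have hyT : y ∈ typeSubmodule E m i i := ((mem_integralHodgeClassesIn_iff Φ).1 hyH).2
  have hmem : (u : E [⋀^Fin k]→L[ℝ] ℂ) ∈ (primitiveForms η m ⊓ (typeSubmodule E m i i ⊔ typeSubmodule E m i i)).map (lefschetzPow η s h) :=
    Submodule.mem_map.2 ⟨y, ⟨hyP, Submodule.mem_sup_left hyT⟩, hu.symm⟩
  rcases Nat.even_or_odd i with hi | hi
  · rw [hi.neg_one_pow, one_mul]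
    exact hd.mul_apply_self_pos_of_mem_posPart hη hk hkq hq hγ e hn hB
      (map_lefschetzPow_primitiveForms_inf_typeSubmodule_sup_le_posPart η hη.1 hm hi hi h hmem) hu0
  · rw [hi.neg_one_pow, neg_one_mul, neg_pos]
    exact hd.mul_apply_self_neg_of_mem_negPart hη hk hkq hq hγ e hn hB
      (map_lefschetzPow_primitiveForms_inf_typeSubmodule_sup_le_negPart η hη.1 hm hi hi h hmem) hu0

/-- **`B_k` is anisotropic on each Lefschetz piece**: `B(u, u) = 0 ⟹ u = 0` for `u = Lˢ y`, `y ∈ Hdgⁱ(X, ℤ)` primitive.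
[cite: VoisinHodgeI2002, §6.3.2 Thm. 6.32 (PDF p. 128)] -/
theorem IsPolarizationType.eq_zero_of_eq_lefschetzPow_of_apply_self_eq_zero (hd : IsPolarizationType Φ η d) (hη : IsRiemannForm Φ η)
    (hkq : k + q = j + 2) (hq : q ≤ j + 2) {γ : E [⋀^Fin (2 * q)]→L[ℝ] ℂ}
    (hγ : wedgePow (ofRealForm η) q = ((q.factorial * ∏ i : Fin q, d (Fin.castLE hq i) : ℕ) : ℂ) • γ)
    (e : Fin n ≃ ι) (hn : k + (2 * q + k) = n) {B : BilinForm ℤ ↥(integralForms Φ k)}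
    (hB : ∀ x y : ↥(integralForms Φ k),
      ((B x y : ℤ) : ℂ) = poincarePairing Φ e hn (x : E [⋀^Fin k]→L[ℝ] ℂ) (γ.wedge (y : E [⋀^Fin k]→L[ℝ] ℂ)))
    {s m i : ℕ} (hm : i + i = m) (h : 2 * s + m = k) {y : E [⋀^Fin m]→L[ℝ] ℂ} (hyH : y ∈ integralHodgeClassesIn Φ m i)
    (hyP : y ∈ primitiveForms η m) {u : ↥(integralForms Φ k)} (hu : (u : E [⋀^Fin k]→L[ℝ] ℂ) = lefschetzPow η s h y) (hB0 : B u u = 0) :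
    u = 0 := by
  by_contra hu0
  have hpos := hd.neg_one_pow_mul_apply_self_pos_of_eq_lefschetzPow hη hkq hq hγ e hn hB hm h hyH hyP hu hu0
  rw [hB0, mul_zero, mul_zero] at hpos
  exact lt_irrefl _ hpos

end Elements

/-! ## §2 The pieces as sublattices of `Hᵏ(X, ℤ)`: existence, independence, containment in `Hdgᵖ(X, ℤ)`, finite index with a uniform exponent -/

section Pieces

variable {ι : Type*} [Fintype ι] [DecidableEq ι] {E : Type*} [NormedAddCommGroup E] [NormedSpace ℂ E]
  {Φ : (ι → ℝ) ≃L[ℝ] E} {j n k q p : ℕ} {η : E [⋀^Fin 2]→L[ℝ] ℝ} {d : Fin (j + 2) → ℕ}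

omit [Fintype ι] [DecidableEq ι] in
variable (Φ η) in
/-- **The Lefschetz pieces exist as sublattices**: for `k = p + p` there is a family `N : Fin (p + 1) → (sublattices of Hᵏ(X, ℤ))` with `u ∈ N_s` iff
`u = Lˢ y` for an integral Hodge class `y ∈ Hdgⁱ(X, ℤ)` which is primitive, `2s + m = k`, `i + i = m` (so `N_s = Lˢ Hdg^{p−s}(X, ℤ)_prim`, `s ≤ p`).
[cite: Lange2023AbelianVarietiesComplex, §5.4.1 (5.22)–(5.23) (PDF p. 275); §7.3.2 (3)] -/
theorem exists_family_mem_iff_exists_eq_lefschetzPow (hpk : p + p = k) :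
    ∃ N : Fin (p + 1) → Submodule ℤ ↥(integralForms Φ k), ∀ (s : Fin (p + 1)) (u : ↥(integralForms Φ k)), u ∈ N s ↔
      ∃ (m i : ℕ) (_ : i + i = m) (h : 2 * (s : ℕ) + m = k) (y : E [⋀^Fin m]→L[ℝ] ℂ),
        y ∈ integralHodgeClassesIn Φ m i ∧ y ∈ primitiveForms η m ∧ (u : E [⋀^Fin k]→L[ℝ] ℂ) = lefschetzPow η (s : ℕ) h y := by
  refine ⟨fun s ↦
    { carrier := {u | ∃ (m i : ℕ) (_ : i + i = m) (h : 2 * (s : ℕ) + m = k) (y : E [⋀^Fin m]→L[ℝ] ℂ),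
        y ∈ integralHodgeClassesIn Φ m i ∧ y ∈ primitiveForms η m ∧ (u : E [⋀^Fin k]→L[ℝ] ℂ) = lefschetzPow η (s : ℕ) h y}
      add_mem' := ?_
      zero_mem' := ?_
      smul_mem' := ?_ }, fun s u ↦ Iff.rfl⟩
  · rintro a b ⟨m, i, hm, h, y, hyH, hyP, hy⟩ ⟨m', i', hm', h', y', hy'H, hy'P, hy'⟩
    obtain rfl : m = m' := by omega
    obtain rfl : i = i' := by omega
    refine ⟨m, i, hm, h, y + y', AddSubgroup.add_mem _ hyH hy'H, (primitiveForms η m).add_mem hyP hy'P, ?_⟩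
    rw [AddSubgroup.coe_add, hy, hy', map_add]
  · have hs := s.is_le
    exact ⟨k - 2 * (s : ℕ), p - (s : ℕ), by omega, by omega, 0, AddSubgroup.zero_mem _, (primitiveForms η _).zero_mem,
      by rw [map_zero]; rfl⟩
  · rintro c u ⟨m, i, hm, h, y, hyH, hyP, hy⟩
    refine ⟨m, i, hm, h, (c : ℂ) • y, ?_, (primitiveForms η m).smul_mem _ hyP, ?_⟩
    · rw [Int.cast_smul_eq_zsmul ℂ c]
      exact AddSubgroup.zsmul_mem _ hyH c
    · rw [map_smul, ← hy, Int.cast_smul_eq_zsmul]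
      rfl

/-- **THE LEFSCHETZ PIECES ARE PAIRWISE ORTHOGONAL, ANISOTROPIC AND INDEPENDENT**: for any family `N` of sublattices of `Hᵏ(X, ℤ)` with
`N_s = Lˢ Hdg^{p−s}(X, ℤ)_prim` (membership predicate `hN`), the pieces are pairwise `B_k`-orthogonal (Lemma 6.31 on the lattice), `B_k` is anisotropic on
each (Hodge–Riemann over `ℤ`, sign `(−1)^{p−s}`), and therefore **`⨆_s N_s` is an internal DIRECT sum: `iSupIndep N`** — the integral Lefschetz
decomposition `⊕_s Lˢ Hdg^{p−s}(X, ℤ)_prim ⊆ Hdgᵖ(X, ℤ)` is an orthogonal direct sum. [cite: VoisinHodgeI2002, §6.3.2 Lemma 6.31, Thm. 6.32 (PDF p. 128); §6.2.3 Rem. 6.27] [cite: Lange2023AbelianVarietiesComplex, §5.4.1 Thm. 5.4.2 and (5.22)–(5.23) (PDF p. 275)] [cite: Huybrechts2016K3, Ch. 14 §0.2] -/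
theorem IsPolarizationType.iSupIndep_lefschetzPieces (hd : IsPolarizationType Φ η d) (hη : IsRiemannForm Φ η)
    (hkq : k + q = j + 2) (hq : q ≤ j + 2) {γ : E [⋀^Fin (2 * q)]→L[ℝ] ℂ}
    (hγ : wedgePow (ofRealForm η) q = ((q.factorial * ∏ i : Fin q, d (Fin.castLE hq i) : ℕ) : ℂ) • γ)
    (e : Fin n ≃ ι) (hn : k + (2 * q + k) = n) {B : BilinForm ℤ ↥(integralForms Φ k)}
    (hB : ∀ x y : ↥(integralForms Φ k),
      ((B x y : ℤ) : ℂ) = poincarePairing Φ e hn (x : E [⋀^Fin k]→L[ℝ] ℂ) (γ.wedge (y : E [⋀^Fin k]→L[ℝ] ℂ)))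
    (N : Fin (p + 1) → Submodule ℤ ↥(integralForms Φ k))
    (hN : ∀ (s : Fin (p + 1)) (u : ↥(integralForms Φ k)), u ∈ N s ↔
      ∃ (m i : ℕ) (_ : i + i = m) (h : 2 * (s : ℕ) + m = k) (y : E [⋀^Fin m]→L[ℝ] ℂ),
        y ∈ integralHodgeClassesIn Φ m i ∧ y ∈ primitiveForms η m ∧ (u : E [⋀^Fin k]→L[ℝ] ℂ) = lefschetzPow η (s : ℕ) h y) :
    iSupIndep N ∧ (∀ s t, s ≠ t → ∀ u ∈ N s, ∀ v ∈ N t, B u v = 0) ∧ (∀ s, ∀ u ∈ N s, B u u = 0 → u = 0) := by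
  have hO : ∀ s t, s ≠ t → ∀ u ∈ N s, ∀ v ∈ N t, B u v = 0 := by
    intro s t hst u hu v hv
    obtain ⟨m, i, -, h, y, -, hyP, hy⟩ := (hN s u).1 hu
    obtain ⟨m', i', -, h', y', -, hy'P, hy'⟩ := (hN t v).1 hv
    exact hd.apply_eq_zero_of_eq_lefschetzPow_of_ne hη hkq hq hγ e hn hB h h' (fun hst' ↦ hst (Fin.ext hst')) hyP hy'P hy hy'
  have hA : ∀ s, ∀ u ∈ N s, B u u = 0 → u = 0 := by
    intro s u hu hB0
    obtain ⟨m, i, hm, h, y, hyH, hyP, hy⟩ := (hN s u).1 hu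
    exact hd.eq_zero_of_eq_lefschetzPow_of_apply_self_eq_zero hη hkq hq hγ e hn hB hm h hyH hyP hy hB0
  exact ⟨iSupIndep_of_forall_apply_eq_zero_of_anisotropic B N hO hA, hO, hA⟩

/-- **`B_k∣N_s` is non-degenerate** on every Lefschetz piece (it is anisotropic). [cite: VoisinHodgeI2002, §6.3.2 Thm. 6.32 (PDF p. 128)] [cite: Huybrechts2016K3, Ch. 14 §0.1] -/
theorem IsPolarizationType.nondegenerate_restrict_lefschetzPiece (hd : IsPolarizationType Φ η d) (hη : IsRiemannForm Φ η)
    (hkq : k + q = j + 2) (hq : q ≤ j + 2) {γ : E [⋀^Fin (2 * q)]→L[ℝ] ℂ}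
    (hγ : wedgePow (ofRealForm η) q = ((q.factorial * ∏ i : Fin q, d (Fin.castLE hq i) : ℕ) : ℂ) • γ)
    (e : Fin n ≃ ι) (hn : k + (2 * q + k) = n) {B : BilinForm ℤ ↥(integralForms Φ k)}
    (hB : ∀ x y : ↥(integralForms Φ k),
      ((B x y : ℤ) : ℂ) = poincarePairing Φ e hn (x : E [⋀^Fin k]→L[ℝ] ℂ) (γ.wedge (y : E [⋀^Fin k]→L[ℝ] ℂ)))
    {s : ℕ} {N : Submodule ℤ ↥(integralForms Φ k)}
    (hN : ∀ u : ↥(integralForms Φ k), u ∈ N ↔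
      ∃ (m i : ℕ) (_ : i + i = m) (h : 2 * s + m = k) (y : E [⋀^Fin m]→L[ℝ] ℂ),
        y ∈ integralHodgeClassesIn Φ m i ∧ y ∈ primitiveForms η m ∧ (u : E [⋀^Fin k]→L[ℝ] ℂ) = lefschetzPow η s h y) :
    (B.restrict N).Nondegenerate := by
  have hA : ∀ u : ↥N, B (u : ↥(integralForms Φ k)) (u : ↥(integralForms Φ k)) = 0 → u = 0 := fun u hB0 ↦ by
    obtain ⟨m, i, hm, h, y, hyH, hyP, hy⟩ := (hN u).1 u.2
    exact Subtype.ext (hd.eq_zero_of_eq_lefschetzPow_of_apply_self_eq_zero hη hkq hq hγ e hn hB hm h hyH hyP hy hB0)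
  exact ⟨fun u hu ↦ hA u (hu u), fun u hu ↦ hA u (hu u)⟩

omit [Fintype ι] [DecidableEq ι] in
/-- **Every Lefschetz piece lies in the integral Hodge lattice `Hdgᵖ(X, ℤ)`** (`k = p + p`): `Lˢ Hdg^{p−s}(X, ℤ) ⊆ Hdgᵖ(X, ℤ)`.
[cite: VoisinHodgeI2002, §6.2.3 Lemma 6.26, Rem. 6.27 (PDF p. 126)] [cite: Lange2023AbelianVarietiesComplex, §7.3.2 (1), (3)] -/
theorem coe_mem_integralHodgeClassesIn_of_mem_lefschetzPiece (hη : IsRiemannForm Φ η) (hpk : p + p = k) {s : ℕ}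
    {N : Submodule ℤ ↥(integralForms Φ k)}
    (hN : ∀ u : ↥(integralForms Φ k), u ∈ N ↔
      ∃ (m i : ℕ) (_ : i + i = m) (h : 2 * s + m = k) (y : E [⋀^Fin m]→L[ℝ] ℂ),
        y ∈ integralHodgeClassesIn Φ m i ∧ y ∈ primitiveForms η m ∧ (u : E [⋀^Fin k]→L[ℝ] ℂ) = lefschetzPow η s h y)
    {u : ↥(integralForms Φ k)} (hu : u ∈ N) : (u : E [⋀^Fin k]→L[ℝ] ℂ) ∈ integralHodgeClassesIn Φ k p := by
  obtain ⟨m, i, hm, h, y, hyH, -, hy⟩ := (hN u).1 hu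
  rw [hy]
  exact lefschetzPow_mem_integralHodgeClassesIn hη h (by omega) hyH

omit [DecidableEq ι] in
/-- **THE PIECES HAVE FINITE INDEX IN `Hdgᵖ(X, ℤ)`, WITH A UNIFORM EXPONENT: `N₀ · Hdgᵖ(X, ℤ) ⊆ ⨆_s N_s`** for ONE `N₀ ≥ 1` (`k = p + p ≤ g`): by
g47-#2 every `x ∈ Hdgᵖ(X, ℤ)` has `N₀·x = Σ_{i ≤ p} L^{p−i} yᵢ` with `yᵢ ∈ Hdgⁱ(X, ℤ)` primitive, and `L^{p−i} yᵢ ∈ N_{p−i}`. Together with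
`iSupIndep_lefschetzPieces` and `coe_mem_integralHodgeClassesIn_of_mem_lefschetzPiece`: **`⊕_s Lˢ Hdg^{p−s}(X, ℤ)_prim ⊆ Hdgᵖ(X, ℤ)` is an
orthogonal direct sum of finite index, the quotient being killed by `N₀`** (Lange (5.22)–(5.23) on the Hodge lattice).
[cite: Lange2023AbelianVarietiesComplex, §5.4.1 Thm. 5.4.2 and (5.22)–(5.23) (PDF p. 275); §7.3.2 (3)] [cite: VoisinHodgeI2002, §6.2.3 Rem. 6.27 (PDF p. 126); §7.1.2 (PDF p. 134)] [cite: Kitaoka1993, Ch. 5 Prop. 5.3.3 (proof)] -/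
theorem IsPolarizationType.exists_forall_nsmul_mem_iSup_lefschetzPieces (hd : IsPolarizationType Φ η d) (hη : IsRiemannForm Φ η)
    (hpk : p + p = k) (hk : k ≤ j + 2) (N : Fin (p + 1) → Submodule ℤ ↥(integralForms Φ k))
    (hN : ∀ (s : Fin (p + 1)) (u : ↥(integralForms Φ k)), u ∈ N s ↔
      ∃ (m i : ℕ) (_ : i + i = m) (h : 2 * (s : ℕ) + m = k) (y : E [⋀^Fin m]→L[ℝ] ℂ),
        y ∈ integralHodgeClassesIn Φ m i ∧ y ∈ primitiveForms η m ∧ (u : E [⋀^Fin k]→L[ℝ] ℂ) = lefschetzPow η (s : ℕ) h y) :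
    ∃ N₀ : ℕ, 0 < N₀ ∧ ∀ x : ↥(integralForms Φ k), (x : E [⋀^Fin k]→L[ℝ] ℂ) ∈ integralHodgeClassesIn Φ k p → N₀ • x ∈ ⨆ s, N s := by
  obtain ⟨N₀, hN₀, H⟩ := hd.exists_forall_nsmul_eq_sum_lefschetzPow_primitive_of_add_eq hη p k hpk hk
  refine ⟨N₀, hN₀, fun x hx ↦ ?_⟩
  obtain ⟨z, hsum, hz⟩ := H _ hx
  -- every summand is (the image of) an element of some piece
  have hzS : ∀ i ∈ Finset.range (p + 1), z i ∈ (⨆ s, N s).map (integralForms Φ k).subtype.toIntLinearMap := by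
    intro i hi
    obtain ⟨s, m, hm, h, y, hyH, hyP, hzi⟩ := hz i hi
    have hs : s < p + 1 := by omega
    have hwZ : lefschetzPow η s h y ∈ integralForms Φ k := lefschetzPow_mem_integralForms hη h hyH.1
    have hw : (⟨lefschetzPow η s h y, hwZ⟩ : ↥(integralForms Φ k)) ∈ N ⟨s, hs⟩ :=
      (hN ⟨s, hs⟩ _).2 ⟨m, i, hm, h, y, hyH, hyP, rfl⟩
    rw [hzi]
    exact Submodule.mem_map_of_mem (Submodule.mem_iSup_of_mem (⟨s, hs⟩ : Fin (p + 1)) hw)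
  have hsumS : ∑ i ∈ Finset.range (p + 1), z i ∈ (⨆ s, N s).map (integralForms Φ k).subtype.toIntLinearMap :=
    Submodule.sum_mem _ hzS
  rw [← hsum] at hsumS
  obtain ⟨w, hwS, hw⟩ := Submodule.mem_map.1 hsumS
  have hwx : w = N₀ • x := by
    apply Subtype.ext
    rw [AddSubmonoidClass.coe_nsmul, ← Nat.cast_smul_eq_nsmul ℂ N₀]
    exact hw
  rw [← hwx]
  exact hwS

end Pieces

end Literature.Geometry.Kaehler.ComplexTorus

end
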